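/-
Origin: expansion seat `planner-pub-hodgecm-toy-g5-0`, handover #5 2026-08-18T15:11:55Z (md5 5bb2e258) (`HOME/pub-hodgecm-toy-g5/lean/ToyG5/HodgeRiemannRational3.lean`, md5 5bb2e258, 157 lines);
landed by the gen-8 packager in gate run 31 as `HodgeCM/Model/ToyG2/HodgeRiemannRational3.lean` (import ^import ToyG5\.HodgeRiemannGram3[ \t]*$→import HodgeCM.Model.ToyG2.HodgeRiemannGram3 ×1).
-/
-- HANDOVER (planner-pub-hodgecm-toy-g5-0, unit pub-hodgecm-toy-g5): WIP module `ToyG5.HodgeRiemannRational3`; intended final module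
-- `HodgeCM.Model.ToyG2.HodgeRiemannRational3` (kind L5, toy model / consistency witness, EXPANSION part (e), generation 5);
-- rename `import ToyG5.X` ↦ `import HodgeCM.Model.ToyG2.X` (one import: `HodgeRiemannGram3`, file #4 of this seat).
/-
Copyright (c) 2026. All rights reserved.
Released under Apache 2.0 license as described in the file LICENSE.
-/
import Mathlib
import Summits.HodgeConjecture.HodgeCM.Model.ToyG2.HodgeRiemannGram3
import Summits.HodgeConjecture.HodgeCM.Proofs.Prop22.Basic

/-!
# The radical of the rational cup pairing commutes with `ℂ ⊗_ℚ –`; the HR20 defect of `toyUniverse₃` is RATIONAL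

File #5 of generation 5 of the toy lineage (seat `planner-pub-hodgecm-toy-g5-0`).

§1 is universe-generic linear algebra (any `U : Universe`, any variety `X`, any degree `k`): the rational pairing
`trCup U X k : (x, y) ↦ tr(x ∪ y)` on `H^k(X, ℚ)`, its radical `trCupRad U X k = ker (x ↦ tr(x ∪ –)) ⊆ H^k(X, ℚ)` — a `ℚ`-subspace —
and **`isRadicalC_iff_mem_baseChange`: a complex class `η ∈ H^k(X, ℂ)` satisfies `∀ z, tr_ℂ(η ∪ z) = 0` iff
`η ∈ ℂ ⊗_ℚ trCupRad`** (flatness of `ℂ` over `ℚ`, `Module.Flat.ker_lTensor_eq`, plus a dual-basis computation identifying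
`ker((x ↦ tr(x ∪ –)) ⊗ ℂ)` with the complex radical).

§2 specialises to the period surfaces `P_Γ` of `toyUniverse₃ d t` (`1 ≤ d`, `t² = 16`) and combines with file #4
(`hr3g_radical_of_isotropic`): **`hr3q_isotropic_iff_mem_ratRadical`: for `η ∈ F²H²(P_Γ)`, `tr_ℂ(η ∪ η̄) = 0 ↔ η ∈ ℂ ⊗_ℚ N_ℚ`** with
`N_ℚ := trCupRad (toyUniverse₃ d t) P_Γ 2 ⊆ H²(P_Γ, ℚ)`; hence (`hr3q_HR20_defect_rational`) the set of HR20-violating `(2,0)`-classes is exactly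
`(F² ∩ ℂ ⊗ N_ℚ) ∖ 0` for ONE rational subspace `N_ℚ`, nonzero by file #3.  This is the kernel-checked form of TOY-G5.md §4: the repair of the
toy at the level of `H²(P_Γ)` is the RATIONAL quotient `H²(P_Γ, ℚ) / N_ℚ`.  Nothing cited, nothing posited, no unfinished proofs.
-/

open scoped TensorProduct
open Literature.AlgebraicGeometry.Motives
open Literature.AlgebraicGeometry.Motives.HodgeStructure (conj)

namespace HodgeCM

namespace Universe

noncomputable section

variable (U : Universe) (X : U.Var) (k : ℕ)

/-! ### §1 The rational pairing `tr(x ∪ y)` and its radical; base change to `ℂ` -/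

/-- the rational pairing `x ↦ (y ↦ tr(x ∪ y))` on `H^k(X, ℚ)` with values in `H^k(X, ℚ)^∨` -/
def trCup : U.Coh X k →ₗ[ℚ] Module.Dual ℚ (U.Coh X k) :=
  (U.cup X k k).compr₂ (U.tr X (k + k))

/-- (Ported verbatim from the HodgeCMPerL package; no docstring in the source.) -/
@[simp] theorem trCup_apply (x y : U.Coh X k) : U.trCup X k x y = U.tr X (k + k) (U.cup X k k x y) := rfl

/-- the radical `N_ℚ = {x | ∀ y, tr(x ∪ y) = 0}` of the rational pairing: a `ℚ`-subspace of `H^k(X, ℚ)` -/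
def trCupRad : Submodule ℚ (U.Coh X k) := LinearMap.ker (U.trCup X k)

/-- (Ported verbatim from the HodgeCMPerL package; no docstring in the source.) -/
theorem mem_trCupRad_iff (x : U.Coh X k) :
    x ∈ U.trCupRad X k ↔ ∀ y, U.tr X (k + k) (U.cup X k k x y) = 0 := by
  simp only [trCupRad, LinearMap.mem_ker, LinearMap.ext_iff, trCup_apply, LinearMap.zero_apply]

/-- flatness of `ℂ` over `ℚ`: `ker(trCup ⊗ ℂ) = N_ℚ ⊗ ℂ` inside `H^k(X, ℂ)` -/
theorem ker_trCup_baseChange :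
    LinearMap.ker ((U.trCup X k).baseChange ℂ) = (U.trCupRad X k).baseChange ℂ :=
  Module.Flat.ker_lTensor_eq ℂ ℂ (U.trCup X k)

/-- the complex pairing on pure tensors -/
theorem trC_cup2C_tmul (a b : ℂ) (x y : U.Coh X k) :
    U.trC X (k + k) (U.cup2C X k (a ⊗ₜ x) (b ⊗ₜ y)) = (U.tr X (k + k) (U.cup X k k x y)) • (a * b) := by
  rw [cup2C_tmul, trC_tmul]

/-- coordinates of `(trCup ⊗ ℂ) η` in the base-changed dual basis are the complex pairings `tr_ℂ(η ∪ (1 ⊗ w_l))` -/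
theorem repr_trCup_baseChange {ι : Type*} [Fintype ι] [DecidableEq ι] (w : Module.Basis ι ℚ (U.Coh X k))
    (η : U.CohC X k) (l : ι) :
    (w.dualBasis.baseChange ℂ).repr ((U.trCup X k).baseChange ℂ η) l
      = U.trC X (k + k) (U.cup2C X k η ((1 : ℂ) ⊗ₜ w l)) := by
  induction η using TensorProduct.induction_on with
  | zero => simp only [map_zero, Finsupp.zero_apply, LinearMap.zero_apply]
  | tmul a x =>
    rw [LinearMap.baseChange_tmul, Module.Basis.baseChange_repr_tmul, Module.Basis.dualBasis_repr, trCup_apply,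
      trC_cup2C_tmul, mul_one]
  | add x y hx hy =>
    rw [map_add, map_add, Finsupp.add_apply, hx, hy, LinearMap.map_add₂, map_add]

/-- **radical commutes with base change.** `η ∈ H^k(X, ℂ)` pairs to zero with all of `H^k(X, ℂ)` iff `η ∈ ℂ ⊗_ℚ N_ℚ`. -/
theorem isRadicalC_iff_mem_baseChange (η : U.CohC X k) :
    (∀ z : U.CohC X k, U.trC X (k + k) (U.cup2C X k η z) = 0) ↔ η ∈ (U.trCupRad X k).baseChange ℂ := by
  classical
  let w := Module.finBasis ℚ (U.Coh X k)
  rw [← ker_trCup_baseChange, LinearMap.mem_ker]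
  constructor
  · intro h
    rw [← (w.dualBasis.baseChange ℂ).repr.map_eq_zero_iff]
    ext l
    rw [repr_trCup_baseChange, h, Finsupp.zero_apply]
  · intro h z
    -- the functional `z ↦ tr_ℂ(η ∪ z)` vanishes on the basis `1 ⊗ w_l`
    have hb : U.trC X (k + k) ∘ₗ U.cup2C X k η = 0 := by
      refine (w.baseChange ℂ).ext fun l => ?_
      rw [LinearMap.comp_apply, Module.Basis.baseChange_apply, ← repr_trCup_baseChange, h, map_zero,
        Finsupp.zero_apply, LinearMap.zero_apply]
    exact LinearMap.congr_fun hb z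

/-- in particular the complex radical is spanned by RATIONAL radical classes -/
theorem exists_rat_of_isRadicalC (η : U.CohC X k) (h : ∀ z : U.CohC X k, U.trC X (k + k) (U.cup2C X k η z) = 0) :
    η ∈ Submodule.span ℂ ((fun x : U.Coh X k => ((1 : ℂ) ⊗ₜ[ℚ] x : U.CohC X k)) '' (U.trCupRad X k : Set (U.Coh X k))) := by
  have hη := (U.isRadicalC_iff_mem_baseChange X k η).mp h
  rw [Submodule.baseChange_eq_span] at hη
  simpa only [Submodule.map_coe, TensorProduct.mk_apply] using hη

/-- conversely a rational radical class pairs to zero with everything complex -/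
theorem isRadicalC_of_mem_trCupRad {x : U.Coh X k} (hx : x ∈ U.trCupRad X k) (z : U.CohC X k) :
    U.trC X (k + k) (U.cup2C X k ((1 : ℂ) ⊗ₜ x) z) = 0 :=
  (U.isRadicalC_iff_mem_baseChange X k _).mpr (Submodule.tmul_mem_baseChange_of_mem 1 hx) z

end

end Universe

/-! ### §2 The HR20 defect of `toyUniverse₃` is rational -/

namespace ToyG2

open HodgeCM.Toy HodgeCM.Toy.CMPresentation

noncomputable section

variable (d t : ℚ) {L : CMField} (ι₁ : L →+* ℂ) {V : HermSpace3 L ι₁} (Γ : Level V)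
  (hd : (1 : ℚ) ≤ d) (ht : t ^ 2 = 16)

include hd ht in
/-- **HR-isotropic ⇔ in `ℂ ⊗ N_ℚ`.** For a `(2,0)`-class `η` of `P_Γ` in `toyUniverse₃ d t` (`1 ≤ d`, `t² = 16`):
`tr_ℂ(η ∪ η̄) = 0 ↔ η ∈ ℂ ⊗_ℚ N_ℚ`, `N_ℚ = trCupRad ⊆ H²(P_Γ, ℚ)` the radical of the RATIONAL cup pairing. -/
theorem hr3q_isotropic_iff_mem_ratRadical {η : (toyUniverse₃ d t).CohC ((toyUniverse₃ d t).pms L ι₁ V Γ) 2}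
    (hF : η ∈ ((toyUniverse₃ d t).hodge ((toyUniverse₃ d t).pms L ι₁ V Γ) 2).F 2) :
    (toyUniverse₃ d t).trC ((toyUniverse₃ d t).pms L ι₁ V Γ) 4
        ((toyUniverse₃ d t).cup2C ((toyUniverse₃ d t).pms L ι₁ V Γ) 2 η (conj η)) = 0
      ↔ η ∈ ((toyUniverse₃ d t).trCupRad ((toyUniverse₃ d t).pms L ι₁ V Γ) 2).baseChange ℂ := by
  rw [← (toyUniverse₃ d t).isRadicalC_iff_mem_baseChange ((toyUniverse₃ d t).pms L ι₁ V Γ) 2 η]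
  exact ⟨fun h0 z => hr3g_radical_of_isotropic d t ι₁ Γ hd ht hF h0 z, fun h => h (conj η)⟩

include hd ht in
/-- **THE HR20 DEFECT IS RATIONAL.** There is ONE `ℚ`-subspace `N ⊆ H²(P_Γ, ℚ)` (the radical of `tr ∘ ∪`), with
`ℂ ⊗ N` meeting `F²H²(P_Γ)` non-trivially, such that a `(2,0)`-class violates HR20 (`tr_ℂ(η ∪ η̄) = 0`, `η ≠ 0`) iff it is a
nonzero element of `ℂ ⊗ N`. -/
theorem hr3q_HR20_defect_rational :
    ∃ N : Submodule ℚ ((toyUniverse₃ d t).Coh ((toyUniverse₃ d t).pms L ι₁ V Γ) 2),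
      (∃ η ∈ ((toyUniverse₃ d t).hodge ((toyUniverse₃ d t).pms L ι₁ V Γ) 2).F 2, η ≠ 0 ∧ η ∈ N.baseChange ℂ) ∧
      ∀ η ∈ ((toyUniverse₃ d t).hodge ((toyUniverse₃ d t).pms L ι₁ V Γ) 2).F 2,
        ((toyUniverse₃ d t).trC ((toyUniverse₃ d t).pms L ι₁ V Γ) 4
            ((toyUniverse₃ d t).cup2C ((toyUniverse₃ d t).pms L ι₁ V Γ) 2 η (conj η)) = 0
          ↔ η ∈ N.baseChange ℂ) := by
  obtain ⟨η, hF, hne, hrad⟩ := hr3_radical_witness d t ι₁ Γ hd ht (eQ L ι₁ (qAt L ι₁))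
  refine ⟨(toyUniverse₃ d t).trCupRad ((toyUniverse₃ d t).pms L ι₁ V Γ) 2, ⟨η, hF, hne, ?_⟩,
    fun η hF => hr3q_isotropic_iff_mem_ratRadical d t ι₁ Γ hd ht hF⟩
  exact ((toyUniverse₃ d t).isRadicalC_iff_mem_baseChange _ 2 η).mp hrad

end

end ToyG2

end HodgeCM
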